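import Mathlib

/-!
# Unipotent letter law — MINT block B2 «alphabet UNIPOTENT ∕ homogeneous letters» (hsemireg-alphabet-unipotent-1 g0/g1/g2, 2026-08-29)

Crux of record: `Summit.HodgeConjecture.HodgeConjecture.Theses.EightfoldBlochSeeds.BlochSeedDiscOne`
(item stmt-HodgeConjecture-18881; skeleton `Lines/birth.lean` 814a6a70c14e831a, STUB R `stub_rung_pad4_seedAt` —
UNTOUCHED here).  Nothing in this file proves HC, HC_AV, HC_CM, H2, №4/26512 or item 18881, and nothing here is a
statement about sheaves on `P = ∏_f E_f²`: it is the KERNEL SHADOW of the finitary cores of the cell memo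
`hsemireg-alphabet-unipotent-1/SPEC-UNIPOTENT-LINE-alphabet-unipotent1-g0.md` (v1.9.1 sha16 143ed41175188357, §0–§8c),
typed so that the arithmetic, the counting steps and the strand rules used there are kernel facts and not pencil lines.
Every geometric input (Mukai's dictionary, Künneth, Mumford's index theorem, Bass-number bounds) enters as a HYPOTHESIS
of the stated lemma, labelled below.  Mathlib only; no `sorry`; no instances, no notation, no axioms.

## Dictionary (memo §1–§2; per factor `S_f = E × E`, frame `⟨1, I, e, ē, pt⟩`, `I² = 2·pt`, `e·ē = −pt` as in
`FourierMukaiLetterLaw.lean`)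

* A unipotent LINE letter is a pair `(Z, T)`: `Z` a cell (one LINE letter per factor), `T` an Artinian type of length
  `ℓ = dim T = rk U_T`; its bundle is `𝓤(Z,T) = U_T ⊗ L_Z`.  [model] `TypedLetter.dim = ℓ`.
* LEMMA CH (class neutrality): `ch(U_T ⊗ L_Z) = ℓ · ch(L_Z)` because `U_T` has a filtration with all graded pieces `𝒪`
  (Whitney: `c(U_T) = ∏ 1 = 1`, `ch(U_T) = Σ 1 = ℓ`) — Part A: `whitney_unipotent`, `ch_unipotent`, `Frame.ch_typedLetter`,
  and at design level `classOf_eq_lineClassOf_flatten`: every class functional of a typed design is that of its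
  flattened LINE design with `m := Σ ℓ` — so (A1)/ClassScreen, the (H1) rows, `μ`, rank, Ψ-row, `γ_d` cannot move.
* THEOREM LIVE^• / DIMENSION LAW (memo §8c): for unipotent `W ≠ 0` of rank `r` and a line bundle `M`,
  `H^k(W ⊗ M) ≠ 0 ⇔ H^k(M) ≠ 0`.  Part B types the FILTRATION CALCULUS that proves it: subadditivity of `h^k` along the
  `r`-step `𝒪`-filtration (`le_mul_of_filtration`), additivity of `χ` (`eq_mul_of_filtration`), the Euler characteristic
  of a cohomology vector concentrated in one degree (`euler_concentrated`), hence DIMENSION LAW (i)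
  `h^s(W ⊗ M) = r · h^s(M)` (`dimensionLaw_nondegenerate`) and LIVE^• in the non-degenerate regime (`live_nondegenerate`);
  in the degenerate regime the Bruns–Herzog 9.6.1(a) lower bounds give every Bass number `μ_b ≥ 1` on the window
  `0 ≤ b ≤ d` (`bass_pos`), hence LIVE^• there (`live_degenerate`); the examples `h^•(End U_m) = (m, 2m, m)` and the
  Clebsch–Gordan length check `Σ_{j<m} (2j+1) = m²` (`bass_EndUm`, `clebschGordan_length`).
* THEOREM S (socle transport, memo §5): the counting core is the LAYER-CAKE HALL lemma of Part C — if for every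
  threshold `t ≥ 1` the number of source blocks of size `≥ t` is at most the number of receiver blocks of size `≥ t`
  (what injectivity of the socle strata through module maps gives, Lemma U), then total source mass ≤ total receiver
  mass (`mass_le_of_socleDominance`); contrapositive: a β = 1 KI mass violator overflows SOME socle stratum for EVERY
  type assignment (`socleOverflow_of_massViolation`) — the residue `432/R` of ac808a66 is R-independent in location.
* STRAND ARC RULES (memo §8, layers `0 = top … R−1 = socle`): Part D types the three killed/unmoved rules as Boolean
  arc tables and proves the structural facts used verbatim by `unidiv.py`/`unipotent_live.py`: at `R = 1` the
  killed-into-trivial-⊥ rule has NO arc (= the W₁-KILL lemma of record, `killedIntoTrivial_R_one`), in general it passes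
  exactly `R − 1` source layers (`card_killedIntoTrivial`), never the socle (`socle_not_killedIntoTrivial`); the same-chain
  killed rule `K = Im ad_y` admits all `R·R' − 1` layer pairs except socle → top (`card_killedSameChain`), so the socle
  passes a killed factor iff the receiver has `R' ≥ 2` (UP PARTNER RULE, `socle_passes_killed_iff`) and the top is
  reached through a killed factor iff the source has `R ≥ 2` (DOWN PARTNER RULE, `top_reached_killed_iff`).
* TWO-FACTOR SOCLE CAPACITY LAW + inequality (α) (memo §7c/§7e/§7f): `δ_I(R) = (2u − m_N)⁺ / R²` (Part E, `deltaI`):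
  `δ_I ≡ 0 ⇔ (α): 2u ≤ m_N`, else `δ_I > 0` for EVERY `R ≥ 1` (`deltaI_eq_zero_iff`, `deltaI_pos_iff` — thickening
  divides the obstruction by `R²`, never removes it); the digits of record on bf2edc09 / b59c325e / b45d82cc
  (`u = m_N`: 5 736 ∕ 1 434 ∕ 1 912⁄3 · 12 048 ∕ 3 012 ∕ 4 016⁄3 · 24 096 ∕ 6 024 ∕ 8 032⁄3 at `R = 1, 2, 3`) and on the
  ALPHALP object 837a43e1 (`m_N = 2u`: 0) are `norm_num` facts (`deltaI_digits_*`).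
* SAME-CHAIN JOINT SOCLE fit (memo §7e): `U(R) = 5 736·(8R + 48)/R⁴` reproduces `δ_J = U − 4 = 22 940` at `R = 2` and
  `15 284/3` at `R = 3`, and `U(R) ≤ 4 ⇔ R ≥ 25` exactly (`Ufit_two`, `Ufit_three`, `Ufit_le_four_iff`).
* (R-B-ASYM) robustness (memo §8c (4)(α)): two copies of ONE cell are never (b3)-injective — `σ(x, −x) = 0` for any
  additive `σ` (`twoCopies_not_injective`); the dedicated-room arithmetic on S′ (`≤ 1` copy per N18 cell ⇒ `|Im μ′| ≤ 256`
  vs the undedicated `64`; RB16 corner dead by the rank line `32 − 32 = 0`) is recorded as `example`s.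

Labels: [std] = standard algebra; [model] = a hypothesis standing in for a cited geometric fact (Mukai 1978/1981 via
Chen–Hacon arXiv:0802.1060 §1; Lange, *Abelian Varieties over ℂ* (2023) 1.5.10/1.6.5/1.6.8; Bruns–Herzog 9.6.1(a);
Hartshorne III.12.11); [arith] = digits of record.  Census-neutral; no instrument run is replaced by this file.
-/

set_option linter.dupNamespace false

namespace Summit.HodgeConjecture.HodgeConjecture.Cruxes.BlochSeedDiscOne.UnipotentLetterLaw

open Finset

/-! ## Part A — class neutrality (LEMMA CH) -/

section PartA

/-- [std] Whitney along a unipotent filtration: `r` graded pieces of total Chern class `1` multiply to `1`. -/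
theorem whitney_unipotent {R : Type*} [CommMonoid R] (r : ℕ) : (List.replicate r (1 : R)).prod = 1 := by
  simp

/-- [std] `ch` is additive on the filtration: `r` graded pieces of Chern character `1` sum to `r`. -/
theorem ch_unipotent {R : Type*} [Semiring R] (r : ℕ) : (List.replicate r (1 : R)).sum = r := by
  simp

/-- A typed letter: a cell together with the length `dim = ℓ(T) = rk U_T` of its Artinian type (memo §1). -/
structure TypedLetter (C : Type*) where
  /-- the cell `Z` (one LINE letter per factor) -/
  cell : C
  /-- `ℓ(T) = dim_ℂ T = rk U_T` -/
  dim : ℕ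

variable {C V : Type*} [AddCommMonoid V]

/-- [model] Class of a typed design: `Σ ℓ(T) • ch(L_Z)` (LEMMA CH per letter). -/
def classOf (cl : C → V) (D : List (TypedLetter C)) : V :=
  (D.map fun L => L.dim • cl L.cell).sum

/-- Class of a LINE design `[(m, Z), …]`: `Σ m • ch(L_Z)` (the frame of record, `MConfig.wch`-shape). -/
def lineClassOf (cl : C → V) (D : List (ℕ × C)) : V :=
  (D.map fun p => p.1 • cl p.2).sum

/-- Forget the types, keep the lengths as multiplicities. -/
def flatten (D : List (TypedLetter C)) : List (ℕ × C) :=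
  D.map fun L => (L.dim, L.cell)

/-- **LEMMA CH at design level.** The class of a typed design is the class of its flattened LINE design. -/
theorem classOf_eq_lineClassOf_flatten (cl : C → V) (D : List (TypedLetter C)) :
    classOf cl D = lineClassOf cl (flatten D) := by
  simp only [classOf, lineClassOf, flatten, List.map_map]
  rfl

/-- Every additive class functional (rank, (H1) rows, `μ`, Ψ-row, `γ_d`, …) of a typed design equals the same
functional of the flattened LINE design. -/
theorem functional_eq_of_flatten {A : Type*} [AddCommMonoid A] (φ : V →+ A) (cl : C → V)
    (D : List (TypedLetter C)) : φ (classOf cl D) = φ (lineClassOf cl (flatten D)) := by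
  rw [classOf_eq_lineClassOf_flatten]

/-- Splitting one cell's multiplicity among several types changes nothing: two letters at the same cell contribute
`(ℓ₁ + ℓ₂) • ch(L_Z)`. -/
theorem classOf_two_types_same_cell (cl : C → V) (Z : C) (l₁ l₂ : ℕ) :
    classOf cl [⟨Z, l₁⟩, ⟨Z, l₂⟩] = lineClassOf cl [(l₁ + l₂, Z)] := by
  simp [classOf, lineClassOf, add_nsmul]

/-- The per-factor even frame `s·1 + l·I + e·e + eb·ē + p·pt` (as in `FourierMukaiLetterLaw.Frame`). -/
@[ext]
structure Frame (K : Type*) where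
  /-- coefficient of `1` -/
  s : K
  /-- coefficient of `I` -/
  l : K
  /-- coefficient of `e` -/
  e : K
  /-- coefficient of `ē` -/
  eb : K
  /-- coefficient of `pt` -/
  p : K

namespace Frame

variable {K : Type*} [CommRing K]

/-- `exp x = ch(L_x)` for the letter `x = a·I + b·e + b'·ē`: `1 + x + (a² − b b')·pt`. -/
def exp (a b b' : K) : Frame K := ⟨1, a, b, b', a ^ 2 - b * b'⟩

/-- Scalar multiple. -/
def smul (r : K) (x : Frame K) : Frame K := ⟨r * x.s, r * x.l, r * x.e, r * x.eb, r * x.p⟩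

/-- [model] **LEMMA CH per factor letter**: `ch(U_T ⊗ L_x) = ℓ • exp x` has rank coordinate `ℓ`, `I`-coordinate `ℓ a`,
Weil coordinates `ℓ b`, `ℓ b'` and `χ`-coordinate `ℓ (a² − b b')` — the LINE letter's row times `ℓ`. -/
theorem ch_typedLetter (ℓ a b b' : K) :
    smul ℓ (exp a b b') = ⟨ℓ, ℓ * a, ℓ * b, ℓ * b', ℓ * (a ^ 2 - b * b')⟩ := by
  ext <;> simp [smul, exp]

/-- `det 𝓤(Z,T) = L_Z^{ℓ}`: the `I`/`e`/`ē` coordinates of the determinant letter are `ℓ` times the letter's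
(rule (C) is thickening-blind, memo §5 Lemma C). -/
theorem det_typedLetter (ℓ a b b' : K) :
    (smul ℓ (exp a b b')).l = ℓ * a ∧ (smul ℓ (exp a b b')).e = ℓ * b ∧ (smul ℓ (exp a b b')).eb = ℓ * b' := by
  simp [smul, exp]

end Frame

end PartA

/-! ## Part B — the filtration calculus behind THEOREM LIVE^• and the DIMENSION LAW -/

section PartB

/-- [std] Subadditivity along an `r`-step filtration with constant graded piece: `h_{j+1} ≤ h_j + c`, `h_0 = 0`
`⇒ h_r ≤ r·c` (long exact sequences of `0 → W_{j} → W_{j+1} → 𝒪 → 0` twisted by `M`, `c = h^k(M)`). -/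
theorem le_mul_of_filtration (h : ℕ → ℕ) (c : ℕ) (h0 : h 0 = 0) (step : ∀ j, h (j + 1) ≤ h j + c) :
    ∀ r, h r ≤ r * c := by
  intro r
  induction r with
  | zero => simp [h0]
  | succ n ih =>
    calc h (n + 1) ≤ h n + c := step n
      _ ≤ n * c + c := Nat.add_le_add_right ih c
      _ = (n + 1) * c := by ring

/-- [std] Additivity of `χ` along the filtration: `χ_{j+1} = χ_j + c`, `χ_0 = 0 ⇒ χ_r = r·c`. -/
theorem eq_mul_of_filtration (χ : ℕ → ℤ) (c : ℤ) (h0 : χ 0 = 0) (step : ∀ j, χ (j + 1) = χ j + c) :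
    ∀ r : ℕ, χ r = r * c := by
  intro r
  induction r with
  | zero => simp [h0]
  | succ n ih => rw [step, ih]; push_cast; ring

/-- Vanishing propagates up the filtration: `h^k(M) = 0 ⇒ h^k(W ⊗ M) = 0`. -/
theorem vanish_of_filtration (h : ℕ → ℕ) (h0 : h 0 = 0) (step : ∀ j, h (j + 1) ≤ h j + 0) :
    ∀ r, h r = 0 := by
  intro r
  have := le_mul_of_filtration h 0 h0 step r
  simpa using this

/-- Euler characteristic of a cohomology vector `f : degree ↦ dimension` on degrees `0..g`. -/
def euler (g : ℕ) (f : ℕ → ℕ) : ℤ :=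
  ∑ k ∈ range (g + 1), (-1 : ℤ) ^ k * (f k : ℤ)

/-- [std] A cohomology vector concentrated in degree `s ≤ g` has `χ = (−1)^s h^s`. -/
theorem euler_concentrated (g s : ℕ) (f : ℕ → ℕ) (hs : s ≤ g) (hf : ∀ k, k ≠ s → f k = 0) :
    euler g f = (-1 : ℤ) ^ s * (f s : ℤ) := by
  unfold euler
  rw [sum_eq_single s]
  · intro k _ hk
    simp [hf k hk]
  · intro h
    exact absurd (mem_range.mpr (Nat.lt_succ_of_le hs)) h

/-- **DIMENSION LAW (i)** [model]. `M` non-degenerate of index `s` (Mumford: `h^k(M) = 0` for `k ≠ s`), `W` unipotent of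
rank `r` (`h^k(W ⊗ M) ≤ r·h^k(M)` from the filtration, `χ(W ⊗ M) = r·χ(M)`): then `h^s(W ⊗ M) = r·h^s(M)`. -/
theorem dimensionLaw_nondegenerate (g s r : ℕ) (fM fW : ℕ → ℕ) (hs : s ≤ g)
    (concM : ∀ k, k ≠ s → fM k = 0) (sub : ∀ k, fW k ≤ r * fM k)
    (chi : euler g fW = r * euler g fM) : fW s = r * fM s := by
  have concW : ∀ k, k ≠ s → fW k = 0 := by
    intro k hk
    have := sub k
    rw [concM k hk, mul_zero] at this
    exact Nat.le_zero.mp this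
  rw [euler_concentrated g s fW hs concW, euler_concentrated g s fM hs concM] at chi
  rcases Nat.even_or_odd s with he | ho
  · rw [he.neg_one_pow] at chi
    simp only [one_mul] at chi
    exact_mod_cast (by linarith : (fW s : ℤ) = r * fM s)
  · rw [ho.neg_one_pow] at chi
    exact_mod_cast (by linarith : (fW s : ℤ) = r * fM s)

/-- **THEOREM LIVE^•, non-degenerate regime** [model]: with `r ≥ 1`, `H^k(W ⊗ M) ≠ 0 ⇔ H^k(M) ≠ 0` for every `k`. -/
theorem live_nondegenerate (g s r : ℕ) (hr : 1 ≤ r) (fM fW : ℕ → ℕ) (hs : s ≤ g)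
    (concM : ∀ k, k ≠ s → fM k = 0) (sub : ∀ k, fW k ≤ r * fM k)
    (chi : euler g fW = r * euler g fM) : ∀ k, fW k ≠ 0 ↔ fM k ≠ 0 := by
  intro k
  by_cases hk : k = s
  · subst hk
    rw [dimensionLaw_nondegenerate g k r fM fW hs concM sub chi]
    constructor
    · intro h hM; exact h (by rw [hM, mul_zero])
    · intro h hW
      rcases Nat.mul_eq_zero.mp hW with h1 | h1
      · omega
      · exact h h1
  · have hW : fW k = 0 := by
      have := sub k; rw [concM k hk, mul_zero] at this; exact Nat.le_zero.mp this
    simp [hW, concM k hk]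

/-- THEOREM LIVE, `k = 0` (memo §8b) [model]: `𝒪 = W₁ ⊂ W` and `H⁰` left exact give `h⁰(M) ≤ h⁰(W ⊗ M)`; with
`h⁰(W ⊗ M) ≤ r·h⁰(M)` the live predicate is alphabet-independent. -/
theorem live_degree_zero (r h0M h0W : ℕ) (mono : h0M ≤ h0W) (sub : h0W ≤ r * h0M) :
    h0W ≠ 0 ↔ h0M ≠ 0 := by
  constructor
  · intro h hM; apply h; rw [hM, mul_zero] at sub; exact Nat.le_zero.mp sub
  · intro h hW; apply h; rw [hW] at mono; exact Nat.le_zero.mp mono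

/-- [model: Bruns–Herzog 9.6.1(a), depth 0, regular local ring of dimension `d ≥ 1` containing a field] the Bass numbers of
a non-zero Artinian module satisfy `μ_0 ≥ 1`, `μ_1 ≥ d`, `μ_b ≥ 2(d − b) + 1` (`2 ≤ b ≤ d`); hence ALL `μ_b ≥ 1` on
`0 ≤ b ≤ d`. -/
theorem bass_pos (d : ℕ) (hd : 1 ≤ d) (μ : ℕ → ℕ) (h0 : 1 ≤ μ 0) (h1 : d ≤ μ 1)
    (hb : ∀ b, 2 ≤ b → b ≤ d → 2 * (d - b) + 1 ≤ μ b) : ∀ b, b ≤ d → 1 ≤ μ b := by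
  intro b hbd
  rcases Nat.lt_or_ge b 2 with hlt | hge
  · interval_cases b
    · exact h0
    · exact le_trans hd h1
  · exact le_trans (by omega) (hb b hge hbd)

/-- The case `d = 0` is DIMENSION LAW (i); for bookkeeping: `μ_0 ≥ 1` alone covers the window `{0}`. -/
theorem bass_pos_zero (μ : ℕ → ℕ) (h0 : 1 ≤ μ 0) : ∀ b, b ≤ 0 → 1 ≤ μ b := by
  intro b hb; rw [Nat.le_zero.mp hb]; exact h0

/-- **THEOREM LIVE^•, degenerate regime** [model]. DIMENSION LAW (iii): `h^{s+b}(W ⊗ M) = μ_b(W|_K)·Pfr(E)` for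
`0 ≤ b ≤ d` with `Pfr ≥ 1` and every `μ_b ≥ 1`; so `H^{s+b}(W ⊗ M) ≠ 0` on the whole window `[s, s + d]`,
which is the support of `H^•(M)` (Lange 1.6.8: `h^{s+b}(M) = C(d,b)·Pfr`). -/
theorem live_degenerate (s d Pfr : ℕ) (hP : 1 ≤ Pfr) (μ fW fM : ℕ → ℕ)
    (hμ : ∀ b, b ≤ d → 1 ≤ μ b)
    (dimW : ∀ b, b ≤ d → fW (s + b) = μ b * Pfr)
    (dimM : ∀ b, b ≤ d → fM (s + b) = Nat.choose d b * Pfr)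
    (outW : ∀ k, k < s ∨ s + d < k → fW k = 0) (outM : ∀ k, k < s ∨ s + d < k → fM k = 0) :
    ∀ k, fW k ≠ 0 ↔ fM k ≠ 0 := by
  intro k
  by_cases hk : s ≤ k ∧ k ≤ s + d
  · obtain ⟨b, rfl⟩ : ∃ b, k = s + b := ⟨k - s, by omega⟩
    have hb : b ≤ d := by omega
    rw [dimW b hb, dimM b hb]
    have h1 : μ b * Pfr ≠ 0 := Nat.mul_ne_zero (by have := hμ b hb; omega) (by omega)
    have h2 : Nat.choose d b * Pfr ≠ 0 := Nat.mul_ne_zero (Nat.choose_pos hb).ne' (by omega)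
    simp [h1, h2]
  · have hk' : k < s ∨ s + d < k := by omega
    simp [outW k hk', outM k hk']

/-- Vanishing outside the window for `W ⊗ M` follows from the filtration bound and Lange 1.6.8 for `M`. -/
theorem out_of_window (r s d : ℕ) (fW fM : ℕ → ℕ) (sub : ∀ k, fW k ≤ r * fM k)
    (outM : ∀ k, k < s ∨ s + d < k → fM k = 0) : ∀ k, k < s ∨ s + d < k → fW k = 0 := by
  intro k hk
  have := sub k
  rw [outM k hk, mul_zero] at this
  exact Nat.le_zero.mp this

/-- [arith] DIMENSION LAW examples: the Bass numbers of `End U_m` (`T = ℂ[t]/t^m`, abelian surface) sum to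
`(m, 2m, m)` from `m` complete-intersection summands `(1, 2, 1)` each. -/
theorem bass_EndUm (m : ℕ) :
    (∑ _j ∈ range m, (1 : ℕ), ∑ _j ∈ range m, (2 : ℕ), ∑ _j ∈ range m, (1 : ℕ)) = (m, 2 * m, m) := by
  simp [mul_comm]

/-- [std] Clebsch–Gordan length check for `T^∨ ⊗ T ≅ ⊕_{j=1}^{m} ℂ[t]/t^{2j−1}`: `Σ_{j<m} (2j + 1) = m²`. -/
theorem clebschGordan_length (m : ℕ) : ∑ j ∈ range m, (2 * j + 1) = m ^ 2 := by
  induction m with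
  | zero => simp
  | succ n ih => rw [sum_range_succ, ih]; ring

end PartB

/-! ## Part C — THEOREM S: the layer-cake Hall lemma (socle transport) -/

section PartC

/-- Number of blocks of size in `[t, B)`: with `a r` = number of Jordan blocks of size `r`, `tail a t B` is the
dimension of the socle stratum «blocks of size `≥ t`» (all sizes `< B`). -/
def tail (a : ℕ → ℕ) (t B : ℕ) : ℕ := ∑ r ∈ Ico t B, a r

theorem tail_succ (a : ℕ → ℕ) {t B : ℕ} (h : t ≤ B) : tail a t (B + 1) = tail a t B + a B := by
  unfold tail
  rw [sum_Ico_succ_top h]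

theorem tail_self_succ (a : ℕ → ℕ) (B : ℕ) : tail a B (B + 1) = a B := by
  unfold tail
  simp

/-- [std] **Layer cake.** Total mass `Σ r·a_r` = `Σ_{t ≥ 1}` (number of blocks of size `≥ t`): a block of size `r`
is counted once for each threshold `t ≤ r`. -/
theorem layerCake (a : ℕ → ℕ) (B : ℕ) :
    ∑ r ∈ range B, r * a r = ∑ t ∈ Ico 1 B, tail a t B := by
  induction B with
  | zero => simp [tail]
  | succ B ih =>
    rw [sum_range_succ, ih]
    rcases Nat.eq_zero_or_pos B with hB | hB
    · subst hB; simp [tail]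
    · rw [sum_Ico_succ_top hB, tail_self_succ]
      rw [sum_congr rfl (fun t ht => tail_succ a (B := B) (t := t) (by have := (mem_Ico.mp ht).2; omega))]
      rw [sum_add_distrib, sum_const, Nat.card_Ico, smul_eq_mul]
      obtain ⟨n, rfl⟩ : ∃ n, B = n + 1 := ⟨B - 1, by omega⟩
      rw [Nat.add_sub_cancel, Nat.succ_mul]
      ring

/-- **THEOREM S, counting core** [model: Lemma U — a block of size `r` maps its socle non-trivially only into blocks
of size `≥ r`, so injectivity of the socle strata gives the threshold inequalities]. Socle dominance at every
threshold forces mass dominance: `Σ_U m_a ≤ Σ_{Γ⁰(U)} m_n`. -/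
theorem mass_le_of_socleDominance (a n : ℕ → ℕ) (B : ℕ)
    (dom : ∀ t, 1 ≤ t → tail a t B ≤ tail n t B) :
    ∑ r ∈ range B, r * a r ≤ ∑ r ∈ range B, r * n r := by
  rw [layerCake, layerCake]
  exact sum_le_sum fun t ht => dom t (mem_Ico.mp ht).1

/-- Contrapositive (the β = 1 KI residue is real for EVERY thickening): a mass violator `Σ m_n < Σ m_a` overflows some
socle stratum, whatever the Jordan types — `i|_𝓗` is not injective. -/
theorem socleOverflow_of_massViolation (a n : ℕ → ℕ) (B : ℕ)
    (viol : ∑ r ∈ range B, r * n r < ∑ r ∈ range B, r * a r) :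
    ∃ t, 1 ≤ t ∧ tail n t B < tail a t B := by
  by_contra h
  simp only [not_exists, not_and, not_lt] at h
  exact absurd (mass_le_of_socleDominance a n B h) (not_le.mpr viol)

/-- The matching shadow of Lemma U: an injective, size-monotone transport of blocks yields socle dominance at every
threshold (used cell by cell in `unidiv.py`'s strand graph). -/
theorem card_threshold_le_of_transport {α β : Type*} [Fintype α] [Fintype β] [DecidableEq β]
    (s : α → ℕ) (s' : β → ℕ) (φ : α → β) (hφ : Function.Injective φ) (mono : ∀ x, s x ≤ s' (φ x)) (t : ℕ) :
    (univ.filter fun x => t ≤ s x).card ≤ (univ.filter fun y => t ≤ s' y).card := by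
  apply card_le_card_of_injOn φ
  · intro x hx
    simp only [coe_filter, mem_univ, true_and, Set.mem_setOf_eq] at hx ⊢
    exact le_trans hx (mono x)
  · exact hφ.injOn

/-- … and directly mass dominance. -/
theorem mass_le_of_transport {α β : Type*} [Fintype α] [Fintype β] [DecidableEq β]
    (s : α → ℕ) (s' : β → ℕ) (φ : α → β) (hφ : Function.Injective φ) (mono : ∀ x, s x ≤ s' (φ x)) :
    ∑ x, s x ≤ ∑ y, s' y := by
  calc ∑ x, s x ≤ ∑ x, s' (φ x) := sum_le_sum fun x _ => mono x
    _ = ∑ y ∈ univ.image φ, s' y := by rw [sum_image (fun x _ y _ h => hφ h)]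
    _ ≤ ∑ y, s' y := sum_le_sum_of_subset_of_nonneg (subset_univ _) fun _ _ _ => Nat.zero_le _

/-- [arith] ac808a66, β = 1 KI violator of record: 36 A-cells `Σm = 1 944` against `Γ⁰ = 28` N-cells `Σm = 1 512`;
the relaxed one-factor residue is the socle share `(1944 − 1512)/R = 432/R` (R = 1, 2, 3, 4: 432, 216, 144, 108). -/
theorem residue_ac808a66 :
    (1944 - 1512 : ℚ) / 1 = 432 ∧ (1944 - 1512 : ℚ) / 2 = 216 ∧ (1944 - 1512 : ℚ) / 3 = 144 ∧
      (1944 - 1512 : ℚ) / 4 = 108 := by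
  norm_num

end PartC

/-! ## Part D — the strand arc rules of memo §8 (layers `0 = top, …, R − 1 = socle`) -/

section PartD

/-- Unmoved non-⊥ factor (Lemma U, Toeplitz module maps `ℂ[y]/y^{Ru} → ℂ[y]/y^{Rv}`): layer `j ↦ j'` iff
`j' − j ≥ max(0, Rv − Ru)` (as the Boolean arc table of `unidiv.py`). -/
def unmovedArc (Ru Rv j j' : ℕ) : Bool := decide (j + (Rv - Ru) ≤ j')

/-- Moved, KILLED (`Δ = 1`, key ∈ Σ), into a same-chain non-⊥ letter or a ζ-dedicated ⊥ receiver (Lemma K,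
`K = Im ad_y`): every layer pair except socle → top. -/
def killedSameChainArc (R j j' : ℕ) : Bool := !(decide (j = R - 1) && decide (j' = 0))

/-- Moved, KILLED, into a TRIVIAL ⊥ receiver (Lemma K, `K = {−φy}`): only the source layers `j ≤ R − 2` pass
(the socle dies). -/
def killedIntoTrivialArc (R j : ℕ) : Bool := decide (j + 2 ≤ R)

theorem unmovedArc_iff (Ru Rv j j' : ℕ) : unmovedArc Ru Rv j j' = true ↔ j + (Rv - Ru) ≤ j' := by
  simp [unmovedArc]

theorem killedSameChainArc_iff (R j j' : ℕ) : killedSameChainArc R j j' = true ↔ (j ≠ R - 1 ∨ j' ≠ 0) := by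
  by_cases h1 : j = R - 1 <;> by_cases h2 : j' = 0 <;> simp [killedSameChainArc, h1, h2]

theorem killedIntoTrivialArc_iff (R j : ℕ) : killedIntoTrivialArc R j = true ↔ j + 2 ≤ R := by
  simp [killedIntoTrivialArc]

/-- **W₁-KILL is the case `R = 1`**: a killed step into a trivial ⊥ carries NO layer when `R = 1`. -/
theorem killedIntoTrivial_R_one (j : ℕ) : killedIntoTrivialArc 1 j = false := by
  simp [killedIntoTrivialArc]

/-- The socle never passes a killed step into a trivial receiver (Theorem S, exit (a) needs DEDICATED receivers). -/
theorem socle_not_killedIntoTrivial (R : ℕ) : killedIntoTrivialArc R (R - 1) = false := by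
  simp [killedIntoTrivialArc]; omega

/-- Exactly `R − 1` of the `R` source layers pass a killed step into a trivial ⊥ («the other `r − 1` layers pass»). -/
theorem card_killedIntoTrivial (R : ℕ) :
    ((range R).filter fun j => killedIntoTrivialArc R j = true).card = R - 1 := by
  have : (range R).filter (fun j => killedIntoTrivialArc R j = true) = range (R - 1) := by
    ext j
    simp only [mem_filter, mem_range, killedIntoTrivialArc_iff]
    omega
  rw [this, card_range]

/-- `K = Im ad_y` has codimension `1` in the layer pairs: all `R·R'` pairs except socle → top. -/
theorem card_killedSameChain (R R' : ℕ) (hR : 1 ≤ R) (hR' : 1 ≤ R') :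
    ((range R ×ˢ range R').filter fun p => killedSameChainArc R p.1 p.2 = true).card = R * R' - 1 := by
  have hmem : (R - 1, 0) ∈ range R ×ˢ range R' := by
    simp only [mem_product, mem_range]; omega
  have : (range R ×ˢ range R').filter (fun p => killedSameChainArc R p.1 p.2 = true) =
      (range R ×ˢ range R').erase (R - 1, 0) := by
    ext ⟨j, j'⟩
    simp only [mem_filter, mem_erase, mem_product, mem_range, killedSameChainArc_iff, ne_eq, Prod.mk.injEq]
    omega
  rw [this, card_erase_of_mem hmem, card_product, card_range, card_range]

/-- **UP PARTNER RULE**, killed factor: the source SOCLE passes iff the receiver is same-chain/dedicated with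
`R' ≥ 2` (into a trivial receiver: never, `socle_not_killedIntoTrivial`). -/
theorem socle_passes_killed_iff (R R' : ℕ) :
    (∃ j', j' < R' ∧ killedSameChainArc R (R - 1) j' = true) ↔ 2 ≤ R' := by
  simp only [killedSameChainArc_iff]
  constructor
  · rintro ⟨j', hj', h | h⟩ <;> omega
  · intro h; exact ⟨1, by omega, Or.inr (by omega)⟩

/-- **DOWN PARTNER RULE**, killed factor: the receiver's TOP is reached iff the source has `R ≥ 2`
(from its non-socle layers) — the mechanism by which every KQ / β ≥ 2 kill of record dissolves at `R = 2`. -/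
theorem top_reached_killed_iff (R : ℕ) (hR : 1 ≤ R) :
    (∃ j, j < R ∧ killedSameChainArc R j 0 = true) ↔ 2 ≤ R := by
  simp only [killedSameChainArc_iff]
  constructor
  · rintro ⟨j, hj, h | h⟩ <;> omega
  · intro h; exact ⟨0, by omega, Or.inl (by omega)⟩

/-- Unmoved factor: the source socle survives iff `Rv ≥ Ru`; the target top is reached iff `Rv ≤ Ru` (Lemma U). -/
theorem unmoved_socle_survives_iff (Ru Rv : ℕ) (hRu : 1 ≤ Ru) :
    (∃ j', j' < Rv ∧ unmovedArc Ru Rv (Ru - 1) j' = true) ↔ Ru ≤ Rv := by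
  simp only [unmovedArc_iff]
  constructor
  · rintro ⟨j', hj', h⟩; omega
  · intro h; exact ⟨Rv - 1, by omega, by omega⟩

theorem unmoved_top_reached_iff (Ru Rv : ℕ) (hRu : 1 ≤ Ru) :
    (∃ j, j < Ru ∧ unmovedArc Ru Rv j 0 = true) ↔ Rv ≤ Ru := by
  simp only [unmovedArc_iff]
  constructor
  · rintro ⟨j, hj, h⟩; omega
  · intro h; exact ⟨0, by omega, by omega⟩

/-- [arith] the §8 table at the thicknesses of record: at `R = R' = 2` the killed same-chain rule keeps 3 of 4 layer
pairs and the trivial-⊥ rule keeps 1 of 2 layers; at `R = 3`: 8 of 9 and 2 of 3. -/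
example : ((range 2 ×ˢ range 2).filter fun p => killedSameChainArc 2 p.1 p.2 = true).card = 3 ∧
    ((range 2).filter fun j => killedIntoTrivialArc 2 j = true).card = 1 ∧
    ((range 3 ×ˢ range 3).filter fun p => killedSameChainArc 3 p.1 p.2 = true).card = 8 ∧
    ((range 3).filter fun j => killedIntoTrivialArc 3 j = true).card = 2 := by
  decide

end PartD

/-! ## Part E — TWO-FACTOR SOCLE CAPACITY LAW and inequality (α) -/

section PartE

/-- `δ_I(R) = (2u − m_N)⁺ / R²`: the (socle, socle) demand `2u/R²` of the two A-cells against the socle capacity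
`m_N/R²` of the one receiver agreeing on both killed factors (memo §7c). -/
def deltaI (u mN : ℚ) (R : ℕ) : ℚ := max (2 * u - mN) 0 / (R : ℚ) ^ 2

/-- Half capacity (`m_N = u`, all three designs of record): `δ_I(R) = u/R²`. -/
theorem deltaI_half_capacity (u : ℚ) (hu : 0 ≤ u) (R : ℕ) : deltaI u u R = u / (R : ℚ) ^ 2 := by
  unfold deltaI
  rw [two_mul, add_sub_cancel_right, max_eq_left hu]

/-- **(α) ⇔ δ_I ≡ 0**: for every `R ≥ 1`, `δ_I(R) = 0 ↔ 2u ≤ m_N` — the LOCATION of the obstruction is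
alphabet-independent; thickening only divides it by `R²`. -/
theorem deltaI_eq_zero_iff (u mN : ℚ) (R : ℕ) (hR : 1 ≤ R) : deltaI u mN R = 0 ↔ 2 * u ≤ mN := by
  unfold deltaI
  have hR' : (0 : ℚ) < (R : ℚ) ^ 2 := by positivity
  rw [div_eq_zero_iff, or_iff_left hR'.ne', max_eq_right_iff, sub_nonpos]

theorem deltaI_pos_iff (u mN : ℚ) (R : ℕ) (hR : 1 ≤ R) : 0 < deltaI u mN R ↔ mN < 2 * u := by
  unfold deltaI
  have hR' : (0 : ℚ) < (R : ℚ) ^ 2 := by positivity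
  rw [div_pos_iff_of_pos_right hR', lt_max_iff, or_iff_left (lt_irrefl _), sub_pos]

/-- LEMMA (α-NECESSITY) [model: the columns of the two β = 2 A-cells over a point of Σ are supported on the
`m_N(ζ¹,η¹,⊥,⊥)` rows]: injectivity needs `m_A₁ + m_A₂ ≤ m_N`, i.e. `δ_I(1) = 0` with `2u := m_A₁ + m_A₂`. -/
theorem alpha_necessity (mA₁ mA₂ mN : ℕ) (rank_le_rows : mA₁ + mA₂ ≤ mN) :
    deltaI ((mA₁ + mA₂ : ℚ) / 2) mN 1 = 0 := by
  rw [deltaI_eq_zero_iff _ _ 1 le_rfl]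
  have : ((mA₁ + mA₂ : ℕ) : ℚ) ≤ mN := by exact_mod_cast rank_le_rows
  push_cast at this
  linarith

/-- [arith] digits of record, `u = m_N`: bf2edc09 `u = 5 736`: 5 736 ∕ 1 434 ∕ 1 912⁄3 (= 637⅓) at `R = 1, 2, 3`. -/
theorem deltaI_digits_bf2edc09 :
    deltaI 5736 5736 1 = 5736 ∧ deltaI 5736 5736 2 = 1434 ∧ deltaI 5736 5736 3 = 1912 / 3 := by
  refine ⟨?_, ?_, ?_⟩ <;> rw [deltaI_half_capacity _ (by norm_num)] <;> norm_num

/-- [arith] b59c325e `u = 12 048`: 12 048 ∕ 3 012 ∕ 4 016⁄3. -/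
theorem deltaI_digits_b59c325e :
    deltaI 12048 12048 1 = 12048 ∧ deltaI 12048 12048 2 = 3012 ∧ deltaI 12048 12048 3 = 4016 / 3 := by
  refine ⟨?_, ?_, ?_⟩ <;> rw [deltaI_half_capacity _ (by norm_num)] <;> norm_num

/-- [arith] b45d82cc `u = 24 096`: 24 096 ∕ 6 024 ∕ 8 032⁄3. -/
theorem deltaI_digits_b45d82cc :
    deltaI 24096 24096 1 = 24096 ∧ deltaI 24096 24096 2 = 6024 ∧ deltaI 24096 24096 3 = 8032 / 3 := by
  refine ⟨?_, ?_, ?_⟩ <;> rw [deltaI_half_capacity _ (by norm_num)] <;> norm_num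

/-- [arith] ALPHALP object 837a43e1: `(α)` tight, `m_N = 24 096 = 2u` ⇒ `δ_I ≡ 0`. -/
theorem deltaI_digits_837a43e1 (R : ℕ) (hR : 1 ≤ R) : deltaI 12048 24096 R = 0 := by
  rw [deltaI_eq_zero_iff _ _ R hR]; norm_num

/-- [arith] AUGMENTED-N check (`+u` on the receiver orbit, not a design): `m_N = 2u` clears the corner. -/
theorem deltaI_augmented (u : ℚ) (R : ℕ) (hR : 1 ≤ R) : deltaI u (u + u) R = 0 := by
  rw [deltaI_eq_zero_iff _ _ R hR]; linarith

end PartE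

/-! ## Part F — the SAME-CHAIN JOINT SOCLE fit `U(R) = 5 736·(8R + 48)/R⁴` -/

section PartF

/-- Two-point exact fit of the unfillable socle capacity on bf2edc09's same-chain pair (memo §7e). -/
def Ufit (R : ℕ) : ℚ := 5736 * (8 * R + 48) / (R : ℚ) ^ 4

/-- [arith] `U(2) = 22 944`, so `δ_J(2) = U − 4 = 22 940` (kit j332241 digit). -/
theorem Ufit_two : Ufit 2 = 22944 ∧ Ufit 2 - 4 = 22940 := by
  unfold Ufit; norm_num

/-- [arith] `U(3) = 15 296/3`, so `δ_J(3) = 15 284/3` (keyed `unidiv.py`, R = 3 level log dc9057b2). -/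
theorem Ufit_three : Ufit 3 = 15296 / 3 ∧ Ufit 3 - 4 = 15284 / 3 := by
  unfold Ufit; norm_num

/-- Integer form of the threshold. -/
theorem fit_threshold_nat (R : ℕ) (hR : 1 ≤ R) : 1434 * (8 * R + 48) ≤ R ^ 4 ↔ 25 ≤ R := by
  constructor
  · intro h
    by_contra hlt
    rw [not_le] at hlt
    interval_cases R <;> omega
  · intro h
    have h3 : 15625 ≤ R ^ 3 := by
      calc (15625 : ℕ) = 25 ^ 3 := by norm_num
        _ ≤ R ^ 3 := Nat.pow_le_pow_left h 3
    have h4 : 15625 * R ≤ R ^ 4 := by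
      calc 15625 * R ≤ R ^ 3 * R := Nat.mul_le_mul_right R h3
        _ = R ^ 4 := by ring
    linarith

/-- **KJ passes iff `U(R) ≤ 4` iff `R ≥ 25`** (if the two-point fit extrapolated): no modest thickening clears the
same-chain joint socle obstruction of the bf2edc09 ray. -/
theorem Ufit_le_four_iff (R : ℕ) (hR : 1 ≤ R) : Ufit R ≤ 4 ↔ 25 ≤ R := by
  rw [← fit_threshold_nat R hR]
  unfold Ufit
  have hR4 : (0 : ℚ) < (R : ℚ) ^ 4 := by positivity
  rw [div_le_iff₀ hR4]
  constructor
  · intro h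
    have : (5736 : ℚ) * (8 * R + 48) ≤ 4 * (R : ℚ) ^ 4 := h
    exact_mod_cast (by linarith : (1434 : ℚ) * (8 * R + 48) ≤ (R : ℚ) ^ 4)
  · intro h
    have : ((1434 * (8 * R + 48) : ℕ) : ℚ) ≤ ((R ^ 4 : ℕ) : ℚ) := by exact_mod_cast h
    push_cast at this
    linarith

end PartF

/-! ## Part G — (R-B-ASYM) robustness and the dedicated room on S′ (memo §8c (4)) -/

section PartG

/-- Two split copies of ONE cell (same `ch`, translated / thickened or not): `σ(x, −x) = ch ∪ x − ch ∪ x = 0`, so the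
pair is never (b3)-injective — «deficit ≤ 1 per cell» holds in every alphabet. -/
theorem twoCopies_kernel {V W : Type*} [AddCommGroup V] [AddCommGroup W] (σ : V →+ W) (x : V) :
    σ x + σ (-x) = 0 := by
  simp

theorem twoCopies_not_injective {V W : Type*} [AddCommGroup V] [AddCommGroup W] (σ : V →+ W) (x : V)
    (hx : x ≠ 0) : ¬ Function.Injective fun p : V × V => σ p.1 + σ p.2 := by
  intro hinj
  have h := @hinj (x, -x) (0, 0) (by simp)
  simp only [Prod.mk.injEq, neg_eq_zero, and_self] at h
  exact hx h

/-- [arith] dedicated asymmetric room on S′: at most ONE copy per N18 cell (16 cells, `|Im μ′|` ≤ 16 each) gives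
`|Im μ′| ≤ 256`, four times the undedicated bound `64` (one copy per phase class); RB16 cff03fec is the corner
(all 16 once, `μ′ = −256 i`) and dies by the alphabet-blind rank line `Σm(N_cov) − Σm(P) = 32 − 32 = 0`. -/
example : 16 * 16 = (256 : ℕ) ∧ 4 * 16 = (64 : ℕ) ∧ 256 = 4 * 64 ∧ (32 : ℤ) - 32 = 0 := by norm_num

/-- [arith] RB16 off-diagonal Ext census among the 16 split summands `{2: 768, 3: 27 648, 4: 545 280, 5: 27 648,
6: 768}` is Serre-symmetric (`k ↦ 8 − k`) and the fragile `Ext² = 768 = 48 · 16` (48 same-phase ordered pairs of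
type D1·D1·Z·Z, `Pfr = 16`). -/
example : (768 : ℕ) = 48 * 16 ∧ [768, 27648, 545280, 27648, 768].reverse = [768, 27648, 545280, 27648, 768] := by
  norm_num

end PartG

end Summit.HodgeConjecture.HodgeConjecture.Cruxes.BlochSeedDiscOne.UnipotentLetterLaw
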